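import Mathlib
import Literature.RingTheory.CohomologyAnnihilator.Basic
import Literature.AlgebraicGeometry.Resolution.AffineDomainDimension
import Summits.ResolutionOfSingularities.ResolutionOfSingularities.Theorems.SyzygyFlatteningRankOneTerminationStageDim
import Summits.ResolutionOfSingularities.ResolutionOfSingularities.Theorems.HomologicalConductorStrictDropTowerShape
import Summits.ResolutionOfSingularities.ResolutionOfSingularities.Theorems.HomologicalConductorStrictDropRegularDrop
import Summits.ResolutionOfSingularities.ResolutionOfSingularities.Theorems.HomologicalConductorStrictDropDimLEOne
import HarnessLib

/-!
# Crux `StrictDrop` (stmt-ResolutionOfSingularities-16485), line `birth` — the curve case (calibration)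

Route `ResolutionOfSingularities/HomologicalConductor`, crux #4 `StrictDrop`: along the canonical
normalised cohomology-annihilator blow-up tower `T₀ = loc A`, `T_(m+1) = loc (nrm (chart T_m))` of
a finitely generated `A ⊆ O ⊆ K = Frac A` (`O` a valuation ring of `K ⊇ k`), while `T_m` is
singular some later stage carries a non-zero annihilator of value strictly below all of
`ca(T_m) ∖ 0`.

This file PROVES the crux UNCONDITIONALLY in transcendence degree `≤ 1`, i.e. for `A` of Krull
dimension `≤ 1` (curves), with `m' = m + 1`: every stage is a `k`-subalgebra of `K`, so its Krull
dimension is at most `tr.deg_k K = dim A ≤ 1` (`SyzygyFlattening.ringKrullDim_subalgebra_le_syzygyIndex`);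
a singular stage of dimension `≤ 1` is followed by a regular one (the landed dimension step
`DimLEOne.stub_dimLEOne_succ_regular`, Krull–Akizuki), and a regular stage drops the value below
every non-zero annihilator of a singular one (the landed calibration `RegularDrop.stub_regular_drop`:
`1 ∈ ca(T_(m+1))`, `ca(T_m) ⊆ 𝔪`). No use of Iyengar–Takahashi Thm 5.4 is made. (The same three
ingredients settle the route's support item `CurveStep`, `T₁` regular for `dim A = 1`, which is not
this file's business.)

The statement is the crux `StrictDrop` with its `let`-telescope verbatim and the single extra
hypothesis `ringKrullDim ↥A ≤ 1`.
-/

noncomputable section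

-- single-problem summit: the doubled namespace component is forced
set_option linter.dupNamespace false

namespace Summit.ResolutionOfSingularities.ResolutionOfSingularities.Theorems.StrictDrop.Birth.CurveCase

open Literature.AlgebraicGeometry.Resolution (exists_ringKrullDim_eq_and_trdeg_eq trdeg_eq_trdeg_of_isFractionRing)
open Summit.ResolutionOfSingularities.ResolutionOfSingularities.Theorems.SyzygyFlattening
  (syzygyIndex syzygyIndex_eq_trdeg ringKrullDim_subalgebra_le_syzygyIndex)

variable {k K : Type} [Field k] [Field K] [Algebra k K]

/-- For an affine model `A` of `K/k` (`A.FG`, `Frac A = K`) every `k`-subalgebra `B` of `K` has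
`dim B ≤ dim A`: `dim B ≤ tr.deg_k K = tr.deg_k A = dim A`. [cite: Matsumura1987, Thm. 5.6] -/
theorem ringKrullDim_subalgebra_le_of_affineModel (A : Subalgebra k K) (hFG : A.FG)
    (hFrac : IsFractionRing ↥A K) (B : Subalgebra k K) :
    ringKrullDim ↥B ≤ ringKrullDim ↥A := by
  haveI : Algebra.FiniteType k ↥A := A.fg_iff_finiteType.mp hFG
  haveI := hFrac
  obtain ⟨n, hn, htr⟩ := exists_ringKrullDim_eq_and_trdeg_eq k ↥A
  have hsyz : syzygyIndex k K = n := by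
    have h := syzygyIndex_eq_trdeg A hFG hFrac
    rw [trdeg_eq_trdeg_of_isFractionRing A, htr] at h
    exact_mod_cast h
  calc ringKrullDim ↥B ≤ (syzygyIndex k K : WithBot ℕ∞) :=
        ringKrullDim_subalgebra_le_syzygyIndex A hFG hFrac B
    _ = ringKrullDim ↥A := by rw [hsyz, hn]

/-- **The crux `StrictDrop` in dimension `≤ 1` (curves), unconditionally.** Along the canonical
normalised `ca`-tower of a finitely generated `A ⊆ O ⊆ K = Frac A` with `dim A ≤ 1`, a singular stage
`T_m` (of dimension `≤ dim A ≤ 1`) is followed by the REGULAR stage `T_(m+1)` (Krull–Akizuki), which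
carries the non-zero annihilator `y = 1` of value `0 < v(x)` for every non-zero `x ∈ ca(T_m) ⊆ 𝔪_(T_m)`.
[cite: Matsumura1987, Thm. 11.7] -/
theorem strictDrop_of_ringKrullDim_le_one : ∀ p : ℕ, p.Prime → ∀ (k K : Type) [Field k] [CharP k p] [Field K] [Algebra k K] (O : ValuationSubring K) (A : Subalgebra k K), (∀ c : k, algebraMap k K c ∈ O) → A.FG → IsFractionRing ↥A K → A.toSubring ≤ O.toSubring → ringKrullDim ↥A ≤ 1 → let ca : Subalgebra k K → Set K := fun A => {x : K | ∃ hx : x ∈ A, ∃ n : ℕ, ∀ i : ℕ, n ≤ i → ∀ (M N : ModuleCat.{0} ↥A), Module.Finite ↥A M → Module.Finite ↥A N → ∀ e : CategoryTheory.Abelian.Ext.{0} M N i, (⟨x, hx⟩ : ↥A) • e = 0}; let loc : Subalgebra k K → Subalgebra k K := fun A => Algebra.adjoin k {y : K | ∃ a ∈ A, ∃ s ∈ A, s⁻¹ ∈ O ∧ y = a * s⁻¹}; let chart : Subalgebra k K → Subalgebra k K := fun A => Algebra.adjoin k ((A : Set K) ∪ {y : K | ∃ c ∈ ca A, ∃ x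 ∈ ca A, x ≠ 0 ∧ (∀ c' ∈ ca A, c' * x⁻¹ ∈ O) ∧ y = c * x⁻¹}); let nrm : Subalgebra k K → Subalgebra k K := fun B => Algebra.adjoin k {y : K | IsIntegral ↥B y}; let tower : Subalgebra k K → ℕ → Subalgebra k K := fun A m => @Nat.rec (fun _ => Subalgebra k K) (loc A) (fun _ B => loc (nrm (chart B))) m; ∀ m : ℕ, ¬ IsRegularLocalRing ↥(tower A m) → ∃ m' : ℕ, m < m' ∧ ∃ y ∈ ca (tower A m'), y ≠ 0 ∧ ∀ x ∈ ca (tower A m), x ≠ 0 → y * x⁻¹ ∉ O := by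
  intro p hp k K _ _ _ _ O A hk hfg hfrac hle hdimA ca loc chart nrm tower m hm
  have hshape := TowerShape.stub_towerShape p hp k K O A hk hfg hfrac hle
  have hdim : ringKrullDim ↥(tower A m) ≤ 1 :=
    (ringKrullDim_subalgebra_le_of_affineModel A hfg hfrac (tower A m)).trans hdimA
  have hreg : IsRegularLocalRing ↥(tower A (m + 1)) :=
    DimLEOne.stub_dimLEOne_succ_regular p hp k K O A hk hfg hfrac hle hshape m hdim hm
  obtain ⟨y, hy, hy0, hval⟩ :=
    RegularDrop.stub_regular_drop p hp k K O A hk hfg hfrac hle hshape m (m + 1) hm hreg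
  exact ⟨m + 1, Nat.lt_succ_self m, y, hy, hy0, hval⟩

end Summit.ResolutionOfSingularities.ResolutionOfSingularities.Theorems.StrictDrop.Birth.CurveCase

end
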